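import Mathlib

/-!
# `MultiFoldReduction` (stmt-SmoothPoincare4-8139) — arithmetic skeleton of the tree pinch

Support for the informal item `MultiFoldReduction` of route `SymplecticOrigami` (disconnected folds:
a homotopy 4-sphere `M` which is an origami manifold with `k ≥ 2` fold components `Z_j`, cut
pieces `N_a` indexed by the vertices of the dual TREE, centres `B_{a,j}` of genus `g_j` and
self-intersection `e_j` — the SAME on both sides of `Z_j`, Cannas da Silva–Guillemin–Pires 2010
Prop. 2.8).  Companion of `OrigamiRung.Negative.GenusTable` (the connected case `k = 1`).
The topological / Seiberg–Witten inputs are recorded in each docstring as named hypotheses; the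
theorems below are the pure arithmetic that follows, kernel-checked, so that the route's planner
can rely on the NUMBERS of the analysis note attached to the item (evidence
`MultiFoldReduction-analysis.md`, prover seat, 2026-08-16):

* `foldParity` — the parity law: the number of fold components with Euler number `e_j ≠ 0` is ODD
  (so the card's 2-fold example `ℂP² ∪ F₁ ∪ ℂP²` of `S⁴` cannot exist; the honest example is the
  3-fold `ℂP² — F₁ — F₁ — ℂP²`).
* `firstBetti_le_of_bPlus_two_le` — `b⁺ ≥ 2 ⇒ 4 b₁ ≤ 4 + 5 b⁺` (Taubes–Liu `K²_min ≥ 0`).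
* `twoFoldSieve` — `k = 2`: the sieve forces the far leaf to be a DOOR `(b₁, b₂) = (2, 1)` with a
  genus-2 centre of square `1`, the inner piece to have `b₁ = 3` (with `b⁺ = 2`, `b⁻ = 1`,
  `χ = −1`), and the near leaf `b₁ = 2g`.
* `twoFoldSieve_tight` — that tuple satisfies every constraint (the door cannot be sieved away).
* `threeFold_noDoor_consistent` — for `k = 3` the door-FREE tuple `L_T — W — W' — L_T'`
  (`W = (b₁, b₂, b⁺) = (3, 3, 2)`) satisfies every constraint of the sieve: the escape clause
  "some piece has `(b₁, b₂) = (2, 1)`" of the item as filed is NOT forced by the known inputs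
  once `k ≥ 3`.
-/

-- the prescribed namespace `Summit.<P>.<Sub>.…` duplicates `SmoothPoincare4` (P = Sub)
set_option linter.dupNamespace false

namespace Summit.SmoothPoincare4.SmoothPoincare4.Theorems.SymplecticOrigami.MultiFold

/-- **Parity law (arithmetic).**  Notation for a tree fold with `k` components on a homotopy
4-sphere: `z = #{j : e_j = 0}`, `G = Σ_j g_j`, `T = Σ_a t_a` (`t_a` = rank spanned in `H₂(N_a; ℚ)`
by the square-zero centres of `N_a`), `P = Σ_a p_a = 2 · #{j : e_j > 0}` (each fold component with
`e_j > 0` contributes its two centres, one in each adjacent piece; only the parity of `P` matters),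
`B = Σ_a b₁(N_a)`.  Inputs: the `H₁`-count of
the tree Mayer–Vietoris isomorphism `⊕_j H₁(Z_j; ℚ) ≅ ⊕_a H₁(N_a ∖ B; ℚ)`, namely
`B + z = 2G + T` (`hcount`), and the almost-complex parity `b₁(N_a) ≡ 1 + b⁺(N_a) (mod 2)` with
`b⁺(N_a) = p_a + t_a` summed over the `k + 1` pieces (`hpar`).  Output: `z ≡ k + 1 (mod 2)`,
i.e. the number of components with `e_j ≠ 0` is odd. [folklore] -/
theorem foldParity (k z G T P B : ℕ) (hcount : B + z = 2 * G + T)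
    (hpar : B % 2 = (k + 1 + P + T) % 2) (hP : P % 2 = 0) : z % 2 = (k + 1) % 2 := by
  omega

/-- **`b⁺ ≥ 2` bounds `b₁` (arithmetic).**  For a closed symplectic 4-manifold with `b⁺ ≥ 2`:
`K² = 2χ + 3σ = 4 − 4b₁ + 5b⁺ − b⁻` (`hK`), the minimal model has `K²_min = K² + #(blow-ups) ≥ 0`
(Taubes 1996 with Liu 1996 Thm A: minimal symplectic with `K² < 0` is irrational ruled, hence
`b⁺ = 1`) and `#(blow-ups) ≤ b⁻` (`hmin`, `hbl`).  Output: `4 b₁ ≤ 4 + 5 b⁺`. [folklore] -/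
theorem firstBetti_le_of_bPlus_two_le (b₁ bp bm bl : ℕ) (K2 : ℤ)
    (hK : K2 = 4 - 4 * (b₁ : ℤ) + 5 * bp - bm) (hmin : 0 ≤ K2 + bl) (hbl : bl ≤ bm) :
    4 * b₁ ≤ 4 + 5 * bp := by
  omega

/-- **Two-fold sieve (arithmetic core of the `k = 2` theorem).**  A 2-fold origami homotopy
4-sphere has pieces `N₁ — N₂ — N₃` (path), both fold components bound a leaf, so `e₁, e₂ ≥ 0`, and
by `foldParity` exactly one is positive, say `e₁ = 0 < e₂`.  Inputs, with `aᵢ = b₁(Nᵢ)`: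
the `H₁`-count `a₁ + a₂ + a₃ = 2g₁ + 2g₂ + 1` (`hcount`; here `z = 1`, `T = 2`); `a₁ ≤ 2g₁`
(`H¹(N₁) ↪ H¹(B₁)`, from `H₃(M) = 0`); `a₃ ≤ 2` (`N₃` has `b₂ = 1`: Liu 1996 Thm A, or `ℂP²`);
`a₂ ≤ 3` (`N₂` has `b⁺ = 2`, `b⁻ = 1`: `firstBetti_le_of_bPlus_two_le`); and Taubes' adjunction
inequality on the `b⁺ = 2` piece `N₂` for its centre of genus `g₂` and square `e₂ ≥ 1`:
`e₂ ≤ 2g₂ − 2` (`hT`).  Output: `N₃` is a door (`a₃ = 2`, with `b₂ = 1`), `a₂ = 3`, `a₁ = 2g₁`,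
`g₂ = 2`, `e₂ ≤ 2` (and `e₂ = m²` then gives `e₂ = 1`). [folklore] -/
theorem twoFoldSieve (g₁ g₂ e₂ a₁ a₂ a₃ : ℕ)
    (hcount : a₁ + a₂ + a₃ = 2 * g₁ + 2 * g₂ + 1)
    (h₁ : a₁ ≤ 2 * g₁) (h₂ : a₂ ≤ 3) (h₃ : a₃ ≤ 2)
    (he : 1 ≤ e₂) (hT : e₂ + 2 ≤ 2 * g₂) :
    a₃ = 2 ∧ a₂ = 3 ∧ a₁ = 2 * g₁ ∧ g₂ = 2 ∧ e₂ ≤ 2 := by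
  omega

/-- **The square of the door's centre is `1`.**  On the `b₂ = 1` leaf the centre is `m·h` with
`h² = 1`, so `e₂ = m²`; with `1 ≤ e₂ ≤ 2` this forces `m = 1`. [folklore] -/
theorem doorCentre_square_one (m e₂ : ℕ) (hm : e₂ = m ^ 2) (he : 1 ≤ e₂) (he' : e₂ ≤ 2) :
    m = 1 ∧ e₂ = 1 := by
  have hm2 : m ≤ 2 := by nlinarith
  interval_cases m <;> omega

/-- **Tightness of the two-fold sieve.**  The tuple (near leaf `b₁ = 2g₁`, `b₂ = 2`; inner piece
`(b₁, b₂, b⁺, b⁻) = (3, 3, 2, 1)`, `χ = −1`, `K² = 2χ + 3σ = 1`; far leaf the door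
`(b₁, b₂) = (2, 1)`, genus-2 centre of square `1`) meets every constraint of `twoFoldSieve`
together with the per-piece parities `b₁ ≡ 1 + b⁺ (mod 2)` and `K²_min ≥ 0` on the inner piece:
the door disjunct of the item cannot be removed by bookkeeping (it takes `NoGenusTwoDoor`, or the
non-existence of the `χ = −1`, `b⁺ = 2` companion piece). [folklore] -/
theorem twoFoldSieve_tight (g₁ : ℕ) (hg : 1 ≤ g₁) :
    ∃ g₂ e₂ a₁ a₂ a₃ : ℕ,
      a₁ + a₂ + a₃ = 2 * g₁ + 2 * g₂ + 1 ∧ a₁ ≤ 2 * g₁ ∧ a₂ ≤ 3 ∧ a₃ ≤ 2 ∧ 1 ≤ e₂ ∧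
        e₂ + 2 ≤ 2 * g₂ ∧ 2 ≤ 2 * g₁ ∧
        a₁ % 2 = (1 + 1) % 2 ∧ a₂ % 2 = (1 + 2) % 2 ∧ a₃ % 2 = (1 + 1) % 2 ∧
        (0 : ℤ) ≤ (4 - 4 * (a₂ : ℤ) + 5 * 2 - 1) + 1 ∧
        (2 : ℤ) - 2 * a₂ + 3 = -1 ∧ (2 : ℤ) - 2 * a₃ + 1 = -1 := by
  exact ⟨2, 1, 2 * g₁, 3, 2, by omega, le_rfl, le_rfl, le_rfl, le_rfl, by norm_num, by omega,
    by omega, by norm_num, by norm_num, by norm_num, by norm_num, by norm_num⟩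

/-- **`k = 3`: the door-free tuple is numerically consistent.**  Path `N₁ — N₂ — N₃ — N₄` with
Euler numbers `(e₁, e₂, e₃) = (0, e, 0)` (odd number of non-zero ones), genera `(g₁, g₂, g₃) =
(1, 2, 1)`, leaves `N₁, N₄` with `(b₁, b₂) = (2, 2)` (e.g. `S¹ × Y_A`, `Y_A` a torus bundle over
the circle with `b₁ = 1`, centre `S¹ × γ`), inner pieces `N₂, N₃ = W` with
`(b₁, b₂, b⁺, b⁻) = (3, 3, 2, 1)`.  The tuple satisfies: the `H₁`-count
`Σ b₁ = 2Σg − z + T` with `z = 2`, `T = 4`; the per-piece parities; `H¹`-injectivity bounds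
`b₁(N₁) ≤ 2g₁`, `b₁(W) ≤ 2(g₁ + g₂)`; Taubes on `W` (`e ≤ 2g₂ − 2`, `0 ≤ 2g₁ − 2`,
`4b₁ ≤ 4 + 5b⁺`); the edge inequalities `2g₁ + 1 ≤ ρ₁ + ρ₁'`, `2g₂ ≤ ρ₂ + ρ₂'` with admissible
restriction ranks `ρ ≤ min(b₁, 2g)`; and NO piece has `(b₁, b₂) = (2, 1)`.  So for `k ≥ 3` the
known inputs do not force the door disjunct of the item as filed; what they cannot exclude is the
hypothetical `χ = −1`, `b⁺ = 2` piece `W` (Gompf's `χ ≥ 0` corner, `b⁺ = 2` instance). [folklore] -/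
theorem threeFold_noDoor_consistent :
    ∃ g₁ g₂ g₃ e a₁ a₂ a₃ a₄ c₁ c₂ c₃ c₄ ρ₁ ρ₁' ρ₂ ρ₂' : ℕ,
      -- H₁-count: Σ b₁ = 2Σg − z + T, z = 2, T = 4
      a₁ + a₂ + a₃ + a₄ + 2 = 2 * (g₁ + g₂ + g₃) + 4 ∧
      -- parities b₁ ≡ 1 + b⁺: leaves b⁺ = 1, inner b⁺ = 2
      a₁ % 2 = 0 ∧ a₄ % 2 = 0 ∧ a₂ % 2 = 1 ∧ a₃ % 2 = 1 ∧
      -- H¹-injectivity bounds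
      a₁ ≤ 2 * g₁ ∧ a₄ ≤ 2 * g₃ ∧ a₂ ≤ 2 * (g₁ + g₂) ∧ a₃ ≤ 2 * (g₂ + g₃) ∧
      -- Taubes on the b⁺ = 2 pieces
      1 ≤ e ∧ e + 2 ≤ 2 * g₂ ∧ 2 ≤ 2 * g₁ ∧ 2 ≤ 2 * g₃ ∧ 4 * a₂ ≤ 4 + 5 * 2 ∧ 4 * a₃ ≤ 4 + 5 * 2 ∧
      -- edge inequalities with admissible restriction ranks
      2 * g₁ + 1 ≤ ρ₁ + ρ₁' ∧ ρ₁ ≤ a₁ ∧ ρ₁ ≤ 2 * g₁ ∧ ρ₁' ≤ a₂ ∧ ρ₁' ≤ 2 * g₁ ∧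
      2 * g₂ ≤ ρ₂ + ρ₂' ∧ ρ₂ ≤ a₂ ∧ ρ₂ ≤ 2 * g₂ ∧ ρ₂' ≤ a₃ ∧ ρ₂' ≤ 2 * g₂ ∧
      -- Betti numbers b₂: leaves 2, inner 3; Euler characteristics of the inner pieces are −1
      c₁ = 2 ∧ c₄ = 2 ∧ c₂ = 3 ∧ c₃ = 3 ∧ (2 : ℤ) - 2 * a₂ + c₂ = -1 ∧
      -- and no piece is a (2, 1)-door
      ¬ (a₁ = 2 ∧ c₁ = 1) ∧ ¬ (a₂ = 2 ∧ c₂ = 1) ∧ ¬ (a₃ = 2 ∧ c₃ = 1) ∧ ¬ (a₄ = 2 ∧ c₄ = 1) := by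
  refine ⟨1, 2, 1, 1, 2, 3, 3, 2, 2, 3, 3, 2, 2, 1, 2, 2, ?_⟩
  norm_num

end Summit.SmoothPoincare4.SmoothPoincare4.Theorems.SymplecticOrigami.MultiFold
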